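import Literature.RingTheory.MvPolynomial.AbsoluteIrreducibilityReduction
import Mathlib.Algebra.MvPolynomial.Monad
import Mathlib.Algebra.MvPolynomial.CommRing
import HarnessLib

/-!
# Schmidt's norm `‖·‖` on integer polynomials: the elementary inequalities

Support file for the proof of Ostrowski's theorem
(`Literature.RingTheory.MvPolynomial.ostrowski1919_absIrreducible_reduction`, Schmidt,
*Equations over finite fields*, Ch. V, Cor. 2B). Schmidt (Ch. V §1, after Thm. 1D) defines `‖a‖`
as the sum of the absolute values of the coefficients of an integer polynomial `a` in any number
of variables; this is `l1Norm` of `AbsoluteIrreducibilityReduction.lean`. Here we record the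
inequalities used throughout Ch. V §§1–2:

* `‖ab‖ ≤ ‖a‖‖b‖`, `‖a + b‖ ≤ ‖a‖ + ‖b‖`, sums, products, powers, monomials
  (Schmidt, proof of Lemma 1E);
* Lemma 1E: `‖ĝ(b₁, …, bₘ)‖ ≤ ‖ĝ‖ ψ^e` when `deg ĝ ≤ e`, `‖bᵢ‖ ≤ ψ` (`l1Norm_bind₁_le`), together
  with the degree count of Lemma 1B in inequality form (`totalDegree_bind₁_le`);
* the evaluation bound `|g(a)| ≤ ‖g‖ H^{deg g}` for `|aᵢ| ≤ H` used in the proof of Cor. 2B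
  (`natAbs_eval_le`).

No new definitions. All statements are [folklore] bookkeeping; the locators point to where Schmidt
uses them.

## References

* W. M. Schmidt, *Equations over finite fields. An elementary approach*, LNM 536 (1976),
  2nd ed. Kendrick Press (2004), Ch. V §1 (Lemmas 1B, 1E). [`Schmidt1976`]
-/

noncomputable section

open MvPolynomial

namespace Literature.RingTheory.MvPolynomial

variable {σ : Type*}

/-- The norm is the sum of `|coeff|` over any finite set containing the support. [folklore] -/
theorem l1Norm_eq_sum_subset {f : MvPolynomial σ ℤ} {s : Finset (σ →₀ ℕ)} (h : f.support ⊆ s) :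
    l1Norm f = ∑ m ∈ s, (f.coeff m).natAbs := by
  unfold l1Norm
  refine Finset.sum_subset h fun m _ hm => ?_
  rw [notMem_support_iff.mp hm]
  rfl

/-- Each coefficient is bounded by the norm. [folklore] -/
theorem natAbs_coeff_le_l1Norm (f : MvPolynomial σ ℤ) (m : σ →₀ ℕ) :
    (f.coeff m).natAbs ≤ l1Norm f := by
  by_cases hm : m ∈ f.support
  · exact Finset.single_le_sum (f := fun m => (f.coeff m).natAbs) (fun _ _ => Nat.zero_le _) hm
  · rw [notMem_support_iff.mp hm]
    simp

/-- A polynomial of norm zero is zero. [folklore] -/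
theorem eq_zero_of_l1Norm_eq_zero {f : MvPolynomial σ ℤ} (h : l1Norm f = 0) : f = 0 := by
  ext m
  have := natAbs_coeff_le_l1Norm f m
  rw [h, Nat.le_zero, Int.natAbs_eq_zero] at this
  simpa using this

/-- A non-zero integer polynomial has norm at least one. [folklore] -/
theorem one_le_l1Norm {f : MvPolynomial σ ℤ} (h : f ≠ 0) : 1 ≤ l1Norm f :=
  Nat.one_le_iff_ne_zero.mpr fun h0 => h (eq_zero_of_l1Norm_eq_zero h0)

/-- Triangle inequality `‖a + b‖ ≤ ‖a‖ + ‖b‖`. [cite: Schmidt1976, Ch. V §1 (proof of Lemma 1E)] -/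
theorem l1Norm_add_le (f g : MvPolynomial σ ℤ) : l1Norm (f + g) ≤ l1Norm f + l1Norm g := by
  classical
  rw [l1Norm_eq_sum_subset (support_add (p := f) (q := g)),
    l1Norm_eq_sum_subset (Finset.subset_union_left (s₁ := f.support) (s₂ := g.support)),
    l1Norm_eq_sum_subset (Finset.subset_union_right (s₁ := f.support) (s₂ := g.support)),
    ← Finset.sum_add_distrib]
  refine Finset.sum_le_sum fun m _ => ?_
  rw [coeff_add]
  exact Int.natAbs_add_le _ _

/-- `‖-a‖ = ‖a‖`. [folklore] -/
@[simp] theorem l1Norm_neg (f : MvPolynomial σ ℤ) : l1Norm (-f) = l1Norm f := by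
  unfold l1Norm
  rw [support_neg]
  exact Finset.sum_congr rfl fun m _ => by rw [coeff_neg, Int.natAbs_neg]

/-- `‖a - b‖ ≤ ‖a‖ + ‖b‖`. [folklore] -/
theorem l1Norm_sub_le (f g : MvPolynomial σ ℤ) : l1Norm (f - g) ≤ l1Norm f + l1Norm g := by
  rw [sub_eq_add_neg]
  exact (l1Norm_add_le f (-g)).trans (by rw [l1Norm_neg])

/-- `‖Σ aᵢ‖ ≤ Σ ‖aᵢ‖`. [folklore] -/
theorem l1Norm_sum_le {ι : Type*} (s : Finset ι) (f : ι → MvPolynomial σ ℤ) :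
    l1Norm (∑ i ∈ s, f i) ≤ ∑ i ∈ s, l1Norm (f i) := by
  classical
  induction s using Finset.induction_on with
  | empty => simp
  | insert a s ha ih =>
    rw [Finset.sum_insert ha, Finset.sum_insert ha]
    exact (l1Norm_add_le _ _).trans (Nat.add_le_add_left ih _)

/-- The norm of a monomial is the absolute value of its coefficient. [folklore] -/
@[simp] theorem l1Norm_monomial (m : σ →₀ ℕ) (c : ℤ) : l1Norm (monomial m c) = c.natAbs := by
  classical
  unfold l1Norm
  rw [support_monomial]
  split_ifs with h
  · simp [h]
  · simp

/-- The norm of a constant. [folklore] -/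
@[simp] theorem l1Norm_C (c : ℤ) : l1Norm (C c : MvPolynomial σ ℤ) = c.natAbs := by
  rw [← monomial_zero']
  exact l1Norm_monomial 0 c

/-- The norm of a variable is `1`. [folklore] -/
@[simp] theorem l1Norm_X (i : σ) : l1Norm (X i : MvPolynomial σ ℤ) = 1 := by
  rw [X, l1Norm_monomial]
  rfl

/-- The norm of `1` is `1`. [folklore] -/
@[simp] theorem l1Norm_one : l1Norm (1 : MvPolynomial σ ℤ) = 1 := by
  rw [← C_1, l1Norm_C]
  rfl

/-- Submultiplicativity `‖ab‖ ≤ ‖a‖ ‖b‖`. [cite: Schmidt1976, Ch. V §1 (proof of Lemma 1E)] -/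
theorem l1Norm_mul_le (f g : MvPolynomial σ ℤ) : l1Norm (f * g) ≤ l1Norm f * l1Norm g := by
  classical
  have hfg : f * g =
      ∑ m ∈ f.support, ∑ m' ∈ g.support, monomial (m + m') (f.coeff m * g.coeff m') := by
    conv_lhs => rw [f.as_sum, g.as_sum]
    rw [Finset.sum_mul]
    refine Finset.sum_congr rfl fun m _ => ?_
    rw [Finset.mul_sum]
    refine Finset.sum_congr rfl fun m' _ => ?_
    rw [monomial_mul]
  calc l1Norm (f * g)
        = l1Norm (∑ m ∈ f.support, ∑ m' ∈ g.support,
            monomial (m + m') (f.coeff m * g.coeff m')) := by rw [hfg]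
    _ ≤ ∑ m ∈ f.support, l1Norm (∑ m' ∈ g.support,
            monomial (m + m') (f.coeff m * g.coeff m')) := l1Norm_sum_le _ _
    _ ≤ ∑ m ∈ f.support, ∑ m' ∈ g.support, (f.coeff m).natAbs * (g.coeff m').natAbs := by
        refine Finset.sum_le_sum fun m _ => (l1Norm_sum_le _ _).trans (le_of_eq ?_)
        refine Finset.sum_congr rfl fun m' _ => ?_
        rw [l1Norm_monomial, Int.natAbs_mul]
    _ = l1Norm f * l1Norm g := by
        rw [l1Norm, l1Norm, Finset.sum_mul_sum]

/-- `‖∏ aᵢ‖ ≤ ∏ ‖aᵢ‖`. [folklore] -/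
theorem l1Norm_prod_le {ι : Type*} (s : Finset ι) (f : ι → MvPolynomial σ ℤ) :
    l1Norm (∏ i ∈ s, f i) ≤ ∏ i ∈ s, l1Norm (f i) := by
  classical
  induction s using Finset.induction_on with
  | empty => simp
  | insert a s ha ih =>
    rw [Finset.prod_insert ha, Finset.prod_insert ha]
    exact (l1Norm_mul_le _ _).trans (Nat.mul_le_mul_left _ ih)

/-- `‖aⁿ‖ ≤ ‖a‖ⁿ` (e.g. `‖(X - Y)ⁿ‖ = 2ⁿ`). [cite: Schmidt1976, Ch. V §1 (Example before Thm. 1D)] -/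
theorem l1Norm_pow_le (f : MvPolynomial σ ℤ) (n : ℕ) : l1Norm (f ^ n) ≤ l1Norm f ^ n := by
  induction n with
  | zero => simp
  | succ n ih =>
    rw [pow_succ, pow_succ]
    exact (l1Norm_mul_le _ _).trans (Nat.mul_le_mul_right _ ih)

/-- Renaming variables does not increase the norm. [folklore] -/
theorem l1Norm_rename_le {τ : Type*} (e : σ → τ) (f : MvPolynomial σ ℤ) :
    l1Norm (rename e f) ≤ l1Norm f := by
  classical
  conv_lhs => rw [f.as_sum]
  rw [map_sum]
  refine (l1Norm_sum_le _ _).trans (le_of_eq ?_)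
  rw [l1Norm]
  refine Finset.sum_congr rfl fun m _ => ?_
  rw [rename_monomial, l1Norm_monomial]

/-- **Lemma 1B** (degree of a substitution), inequality form: if every `bᵢ` has degree `≤ e'`
then `ĝ(b₁, …, bₘ)` has degree `≤ (deg ĝ) e'`. [cite: Schmidt1976, Ch. V Lemma 1B] -/
theorem totalDegree_bind₁_le {R : Type*} [CommSemiring R] {ι : Type*}
    (θ : ι → MvPolynomial σ R) (D₁ : ℕ) (hθ : ∀ i, (θ i).totalDegree ≤ D₁)
    (g : MvPolynomial ι R) : (bind₁ θ g).totalDegree ≤ g.totalDegree * D₁ := by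
  classical
  conv_lhs => rw [g.as_sum]
  rw [map_sum]
  refine totalDegree_finsetSum_le fun m hm => ?_
  rw [bind₁_monomial]
  refine (totalDegree_mul _ _).trans ?_
  rw [totalDegree_C, zero_add]
  refine (totalDegree_finsetProd _ _).trans ?_
  calc ∑ i ∈ m.support, (θ i ^ m i).totalDegree
        ≤ ∑ i ∈ m.support, m i * D₁ :=
          Finset.sum_le_sum fun i _ => (totalDegree_pow _ _).trans (Nat.mul_le_mul_left _ (hθ i))
    _ = (m.sum fun _ e => e) * D₁ := by rw [Finsupp.sum, Finset.sum_mul]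
    _ ≤ g.totalDegree * D₁ := Nat.mul_le_mul_right _ (le_totalDegree hm)

/-- **Lemma 1E** (norm of a substitution): if `deg ĝ ≤ e` and `‖bᵢ‖ ≤ ψ` (`ψ ≥ 1`) then
`‖ĝ(b₁, …, bₘ)‖ ≤ ‖ĝ‖ ψ^e`. [cite: Schmidt1976, Ch. V Lemma 1E] -/
theorem l1Norm_bind₁_le {ι : Type*} (θ : ι → MvPolynomial σ ℤ) (Ψ : ℕ) (hΨ : 1 ≤ Ψ)
    (hθ : ∀ i, l1Norm (θ i) ≤ Ψ) (g : MvPolynomial ι ℤ) (D : ℕ) (hg : g.totalDegree ≤ D) :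
    l1Norm (bind₁ θ g) ≤ l1Norm g * Ψ ^ D := by
  classical
  conv_lhs => rw [g.as_sum]
  rw [map_sum]
  refine (l1Norm_sum_le _ _).trans ?_
  rw [l1Norm, Finset.sum_mul]
  refine Finset.sum_le_sum fun m hm => ?_
  rw [bind₁_monomial]
  refine (l1Norm_mul_le _ _).trans ?_
  rw [l1Norm_C]
  refine Nat.mul_le_mul_left _ ((l1Norm_prod_le _ _).trans ?_)
  calc ∏ i ∈ m.support, l1Norm (θ i ^ m i)
        ≤ ∏ i ∈ m.support, Ψ ^ m i :=
          Finset.prod_le_prod (fun _ _ => Nat.zero_le _) fun i _ =>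
            (l1Norm_pow_le _ _).trans (Nat.pow_le_pow_left (hθ i) _)
    _ = Ψ ^ (m.sum fun _ e => e) := by rw [Finsupp.sum, Finset.prod_pow_eq_pow_sum]
    _ ≤ Ψ ^ D := Nat.pow_le_pow_right hΨ ((le_totalDegree hm).trans hg)

/-- The evaluation bound of Cor. 2B: `|g(a)| ≤ ‖g‖ H^{deg g}` when `|aᵢ| ≤ H`, `H ≥ 1`.
[cite: Schmidt1976, Ch. V Cor. 2B (proof)] -/
theorem natAbs_eval_le (g : MvPolynomial σ ℤ) (a : σ → ℤ) (H : ℕ) (hH : 1 ≤ H)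
    (ha : ∀ i, (a i).natAbs ≤ H) (D : ℕ) (hg : g.totalDegree ≤ D) :
    (eval a g).natAbs ≤ l1Norm g * H ^ D := by
  classical
  conv_lhs => rw [g.as_sum]
  rw [map_sum]
  refine (Int.natAbs_sum_le _ _).trans ?_
  rw [l1Norm, Finset.sum_mul]
  refine Finset.sum_le_sum fun m hm => ?_
  rw [eval_monomial, Int.natAbs_mul]
  refine Nat.mul_le_mul_left _ ?_
  have hprod : ∀ s : Finset σ, (∏ i ∈ s, a i ^ m i).natAbs = ∏ i ∈ s, (a i).natAbs ^ m i := by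
    intro s
    induction s using Finset.induction_on with
    | empty => simp
    | insert b s hb ih =>
      rw [Finset.prod_insert hb, Finset.prod_insert hb, Int.natAbs_mul, Int.natAbs_pow, ih]
  rw [Finsupp.prod, hprod]
  calc ∏ i ∈ m.support, (a i).natAbs ^ m i
        ≤ ∏ i ∈ m.support, H ^ m i :=
          Finset.prod_le_prod (fun _ _ => Nat.zero_le _) fun i _ => Nat.pow_le_pow_left (ha i) _
    _ = H ^ (m.sum fun _ e => e) := by rw [Finsupp.sum, Finset.prod_pow_eq_pow_sum]
    _ ≤ H ^ D := Nat.pow_le_pow_right hH ((le_totalDegree hm).trans hg)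

end Literature.RingTheory.MvPolynomial
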